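import Literature.IUT.HodgeTheaters.GlobalFrobenioidsCyclotomeIsoGenuineKummer
import HarnessLib

/-!
# [IUTchI] Example 5.1 (v), p. 128 l. 1–12, "respectively, `†𝕄^⊛_∞κ×`" — the one-layer cyclotome display
# `UniqueCyclotomeIso` (FACT-LIST F-2582, sub-DAG row E51/L27) AT ANY STABLE PSEUDO-MONOID and AT THE GENUINE ∞κ×
# KUMMER CONTAINER of the Ex. 5.1 (i) data (proof-only; sequel of `GlobalFrobenioidsCyclotomeIsoGenuineKummer.lean`)

S. Mochizuki, *Inter-universal Teichmüller theory I*, kurims manuscript (May 2020), §5 Example 5.1 (v), p. 127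
l. 75 – p. 128 l. 12 ([IUTchI] Ex 5.1 (v) pp.127–128) [claim: Mochizuki2012, status: disputed]: "there exists a
unique isomorphism of cyclotomes `μ^Θ_Ẑ(π₁(†𝒟^⊚)) ⥲ μ_Ẑ(†𝕄^⊛_∞κ)` (respectively, `μ^Θ_Ẑ(π₁(†𝒟^⊚)) ⥲ μ_Ẑ(†𝕄^⊛_∞κ×)`)
such that the resulting isomorphism between direct limits of cohomology modules induces an isomorphism
`𝕄^⊛_∞κ(†𝒟^⊚) ⥲ †𝕄^⊛_∞κ` (respectively, `𝕄^⊛_∞κ×(†𝒟^⊚) ⥲ †𝕄^⊛_∞κ×`)".  LANA §6.1 pp. 31–32 [LANA2026Report].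

Cell abc-iut, block C / F fact-proving wave, tranche 190 (abc-iut-f-190), FACT-LIST row **F-2582**
`Literature.IUT.HodgeTheaters.UniqueCyclotomeIso` (a SCHEMA; universal closure refuted in tree).  The sibling
`GlobalFrobenioidsCyclotomeIsoGenuineKummer.lean` (p443183) proved the `∞κ` display at the GENUINE Kummer container of
`N : NFBridgeRecon` (`NFBridgeRecon.uniqueCyclotomeIso_infκ_kummerMap` … `_fieldLevel`).  Its proof never used a
property of `𝕄^⊛_∞κ` other than `π₁^rat`-stability and `0 ∉ 𝕄^⊛_∞κ`.

**What this file proves (PROOF-ONLY: no `def`, no `instance`, no new `Prop` fact).**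
* `NFBridgeRecon.uniqueCyclotomeIso_subset_kummerMap` / `…_subset_of_ordHom` — the same uniqueness at ANY
  `π₁^rat`-stable `M ∌ 0` (abc-iut-w4-d056's pair `coricPairOfSubset M hM`, `GlobalFrobenioidsCoricModel.lean`):
  genuine datum ⟨`Λ(K_rat^×)`, `Λ(K_rat^×)`, `lim_{→ i} H¹(S i, Λ(K_rat^×))`, the same, `κ(M)`, `κ(M)`, `e ↦` the
  container twist by the cyclotomic character `χ(e)`⟩; hypotheses `hcoe hprim`, injectivity of `κ` (E51/L26) [resp.
  (o) `hordmul` + finite index], (b′) `hord` on the fixed elements of `M`, Rmk 3.1.7 (i)/(ii) `hpole`/`hex` on the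
  fixed elements of `M`;
* `NFBridgeRecon.uniqueCyclotomeIso_infκx_kummerMap` / `_of_ordHom` / `_of_ordHom_of_fixedRoots` / `_canonical` /
  `_fieldLevel` — the "respectively, `∞κ×`" display at `M := 𝕄^⊛_∞κ×(†𝒟^⊚)`, binders = those of abc-iut-w4-d056's
  conjunct-2 closers `existsUniqueCoricStructure_infκxPair_kummerMap / … / _fieldLevel` minus `h1`/`hpow`/`hnatx`
  (field level: `hrootU hprim hdiv ord hordmul hpolex hexx`).
Law (T) ("`Aut(μ_Ẑ) = Ẑ^×`" + functoriality of `lim_{→} H¹` in the coefficients) is the THEOREM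
`cyclotome.zhatTwist_bijective` + `H1ColimTwist`; the content is "`ℚ_{>0} ∩ Ẑ^× = {1}`"
(`CyclotomeRigidity.eq_one_of_two_zeros_one_pole`).  Reading caveat as in the sibling: `μ^Θ_Ẑ(π₁(†𝒟^⊚))` is read
through its cyclotomic-rigidity identification with `Λ(K_rat^×)` ([AbsTopIII] Thm 1.9 (d)/(e)).  HONEST FRAMING: a
kernel theorem about OUR typed interface at OUR genuine container; no side is taken on [IUTchIII] Cor. 3.12; nothing
of the disputed series is asserted; typed ≠ proved; instantiated ≠ endorsed.
-/

namespace Literature.IUT.HodgeTheaters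

open ProfiniteGrp ProfiniteGrp.ProfiniteCompletion
open Literature.AnabelianGeometry.EtaleTheta Literature.AnabelianGeometry.EtaleTheta.ZHatLevel

namespace NFBridgeRecon

/-! ### The display at any `π₁^rat`-stable pseudo-monoid `M ∌ 0` of rational functions -/

section Subset

variable (N : NFBridgeRecon.{0}) (M : Set N.Krat) (hM : ∀ (g : N.piRat) {f : N.Krat}, f ∈ M → g • f ∈ M)
  [MulDistribMulAction N.piRat N.Kratˣ] {ι : Type} [Preorder ι] [DecidableEq ι] [IsDirectedOrder ι] [Nonempty ι]
  (S : ι → Subgroup N.piRat) (hS : ∀ ⦃i j : ι⦄, i ≤ j → S j ≤ S i) [hN : ∀ i, (S i).Normal] [RootableBy N.Kratˣ ℕ]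

/-- **[IUTchI] Ex. 5.1 (v), p. 128 l. 1–12, AT ANY `π₁^rat`-STABLE PSEUDO-MONOID `M ∌ 0` OF RATIONAL FUNCTIONS**
(the pair `π₁^rat ↷ M`, abc-iut-w4-d056's `coricPairOfSubset`): for the genuine comparison datum ⟨`Λ(K_rat^×)`,
`Λ(K_rat^×)`, `lim_{→ i} H¹(S i, Λ(K_rat^×))`, the same, `κ(M)`, `κ(M)`, `e ↦` twist by `χ(e)`⟩ there is EXACTLY ONE
isomorphism of cyclotomes inducing `κ(M) ⥲ κ(M)`, GIVEN `hcoe`, `hprim`, injectivity of `κ` (E51/L26), (b′) `hord` on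
the `π₁^rat`-fixed elements of `M`, and Rmk 3.1.7 (i)/(ii) in divisor form on the fixed elements of `M` (`hpole`: at
most one pole; `hex`: one with two distinct zeroes).  PROVED (the sibling's `∞κ` proof, verbatim).
([IUTchI] Ex 5.1 (v) p.128) [claim: Mochizuki2012, status: disputed] -/
theorem uniqueCyclotomeIso_subset_kummerMap (h0 : (0 : N.Krat) ∉ M)
    (hcoe : ∀ (g : N.piRat) (a : N.Kratˣ), ((g • a : N.Kratˣ) : N.Krat) = g • (a : N.Krat))
    (hprim : ∀ n : ℕ, 0 < n → ∃ ζ : N.Krat, IsPrimitiveRoot ζ n) (hc : IsExhausted N.Kratˣ S)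
    (hinj : Function.Injective (kummerMap hS hc))
    {X : Type*} (ord : X → N.Krat → ℤ)
    (hord : ∀ (u : MulAut (completion (GrpCat.of (Multiplicative ℤ)))) (f f' : (N.coricPairOfSubset M hM).carrier),
      (∀ g : N.piRat, g • (f : N.Krat) = f) → (∀ g : N.piRat, g • (f' : N.Krat) = f') →
      kummerMap hS hc (Units.mk0 (f' : N.Krat) (N.coe_ne_zero_of_subset M hM h0 f')) =
        H1ColimTwist S hS u (kummerMap hS hc (Units.mk0 (f : N.Krat) (N.coe_ne_zero_of_subset M hM h0 f))) →
      ∀ x : X, u (eta (ord x f)) = eta (ord x f'))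
    (hpole : ∀ f' ∈ M, (∀ g : N.piRat, g • f' = f') →
      ∀ x₁ x₂ : X, x₁ ≠ x₂ → ¬ (ord x₁ f' < 0 ∧ ord x₂ f' < 0))
    (hex : ∃ f ∈ M, (∀ g : N.piRat, g • f = f) ∧
      ∃ x₁ x₂ : X, x₁ ≠ x₂ ∧ 0 < ord x₁ f ∧ 0 < ord x₂ f) :
    UniqueCyclotomeIso
      { μ₁ := cyclotome N.Kratˣ
        μ₂ := cyclotome N.Kratˣ
        H₁ := H1Colimit N.Kratˣ S hS
        H₂ := H1Colimit N.Kratˣ S hS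
        im₁ := Set.range fun f : (N.coricPairOfSubset M hM).carrier =>
          kummerMap hS hc (Units.mk0 (f : N.Krat) (N.coe_ne_zero_of_subset M hM h0 f))
        im₂ := Set.range fun f : (N.coricPairOfSubset M hM).carrier =>
          kummerMap hS hc (Units.mk0 (f : N.Krat) (N.coe_ne_zero_of_subset M hM h0 f))
        induced := fun e => H1ColimTwist S hS
          ((Equiv.ofBijective _ (cyclotome.zhatTwist_bijective (R := N.Krat) hprim)).symm e) } := by
  -- the cyclotomic character `χ : Aut(Λ(K_rat^×)) ⥲ Ẑ^×`, inverse to `zhatTwist`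
  set χ := (Equiv.ofBijective _ (cyclotome.zhatTwist_bijective (R := N.Krat) hprim)).symm with hχ
  have hχ_twist : ∀ e : cyclotome N.Kratˣ ≃* cyclotome N.Kratˣ, cyclotome.zhatTwist N.Kratˣ (χ e) = e :=
    fun e => Equiv.ofBijective_apply_symm_apply _ _ e
  have hχ_one : χ 1 = 1 := by
    rw [hχ, Equiv.symm_apply_eq]
    exact (map_one (cyclotome.zhatTwist N.Kratˣ)).symm
  refine ⟨⟨1, ?_, fun e he => ?_⟩⟩
  · -- EXISTENCE: the identity induces the identity of the container
    change Set.BijOn (fun z => H1ColimTwist S hS (χ 1) z) _ _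
    refine (Set.bijOn_id _).congr fun z _ => ?_
    change z = H1ColimTwist S hS (χ 1) z
    rw [hχ_one, H1ColimTwist_one_apply]
  · -- UNIQUENESS: `e = zhatTwist u`; `u ·` preserves `κ(M)`; divisors force `u = 1`
    change Set.BijOn (fun z => H1ColimTwist S hS (χ e) z) _ _ at he
    obtain ⟨f, hfM, hf, x₁, x₂, hne, h₁, h₂⟩ := hex
    obtain ⟨F', hF'⟩ := he.mapsTo (Set.mem_range_self (⟨f, hfM⟩ : (N.coricPairOfSubset M hM).carrier))
    have hF'fix : ∀ g : N.piRat, g • (F' : N.Krat) = F' := fun g => by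
      have hu := N.fixed_of_kummerMap_eq_H1ColimTwist S hS hc hinj (χ e)
        (N.smul_mk0_of_fixed hcoe
          (N.coe_ne_zero_of_subset M hM h0 (⟨f, hfM⟩ : (N.coricPairOfSubset M hM).carrier)) hf) hF' g
      have hval := congrArg Units.val hu
      rwa [hcoe, Units.val_mk0] at hval
    have hd := hord (χ e) ⟨f, hfM⟩ F' hf hF'fix hF'
    have hu1 : χ e = 1 :=
      CyclotomeRigidity.eq_one_of_two_zeros_one_pole (χ e) h₁ h₂ (hpole F' F'.2 hF'fix x₁ x₂ hne) (hd x₁) (hd x₂)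
    rw [← hχ_twist e, hu1, map_one]

/-- **At any stable `M ∌ 0`, with (b′) from the additivity of `ord_x` on fixed functions (o)** (+ finite index of the
levels).  PROVED. ([IUTchI] Ex 5.1 (v) p.128) [claim: Mochizuki2012, status: disputed] -/
theorem uniqueCyclotomeIso_subset_of_ordHom (h0 : (0 : N.Krat) ∉ M)
    (hcoe : ∀ (g : N.piRat) (a : N.Kratˣ), ((g • a : N.Kratˣ) : N.Krat) = g • (a : N.Krat))
    (hprim : ∀ n : ℕ, 0 < n → ∃ ζ : N.Krat, IsPrimitiveRoot ζ n) (hc : IsExhausted N.Kratˣ S)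
    (hfi : ∀ i, (S i).FiniteIndex) (hinj : Function.Injective (kummerMap hS hc))
    {X : Type*} (ord : X → N.Krat → ℤ)
    (hordmul : ∀ (x : X) (a b : N.Krat), a ≠ 0 → b ≠ 0 → (∀ g : N.piRat, g • a = a) → (∀ g : N.piRat, g • b = b) →
      ord x (a * b) = ord x a + ord x b)
    (hpole : ∀ f' ∈ M, (∀ g : N.piRat, g • f' = f') →
      ∀ x₁ x₂ : X, x₁ ≠ x₂ → ¬ (ord x₁ f' < 0 ∧ ord x₂ f' < 0))
    (hex : ∃ f ∈ M, (∀ g : N.piRat, g • f = f) ∧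
      ∃ x₁ x₂ : X, x₁ ≠ x₂ ∧ 0 < ord x₁ f ∧ 0 < ord x₂ f) :
    UniqueCyclotomeIso
      { μ₁ := cyclotome N.Kratˣ
        μ₂ := cyclotome N.Kratˣ
        H₁ := H1Colimit N.Kratˣ S hS
        H₂ := H1Colimit N.Kratˣ S hS
        im₁ := Set.range fun f : (N.coricPairOfSubset M hM).carrier =>
          kummerMap hS hc (Units.mk0 (f : N.Krat) (N.coe_ne_zero_of_subset M hM h0 f))
        im₂ := Set.range fun f : (N.coricPairOfSubset M hM).carrier =>
          kummerMap hS hc (Units.mk0 (f : N.Krat) (N.coe_ne_zero_of_subset M hM h0 f))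
        induced := fun e => H1ColimTwist S hS
          ((Equiv.ofBijective _ (cyclotome.zhatTwist_bijective (R := N.Krat) hprim)).symm e) } :=
  N.uniqueCyclotomeIso_subset_kummerMap M hM S hS h0 hcoe hprim hc hinj ord
    (fun u f f' hf hf' h x =>
      N.kummerMap_hord_of_ordHom_of_subset M hM S hS h0 hcoe hc hfi ord hordmul u f f' hf hf' h x) hpole hex

end Subset

/-! ### "Respectively, `∞κ×`": the display at `𝕄^⊛_∞κ×(†𝒟^⊚)` -/

section Infκx

variable (N : NFBridgeRecon.{0}) [MulDistribMulAction N.piRat N.Kratˣ] {ι : Type} [Preorder ι]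
  [DecidableEq ι] [IsDirectedOrder ι] [Nonempty ι] (S : ι → Subgroup N.piRat)
  (hS : ∀ ⦃i j : ι⦄, i ≤ j → S j ≤ S i) [hN : ∀ i, (S i).Normal] [RootableBy N.Kratˣ ℕ]

/-- **[IUTchI] Ex. 5.1 (v), p. 128 l. 1–12, "respectively, `†𝕄^⊛_∞κ×`" — AT THE GENUINE ∞κ× KUMMER CONTAINER**:
exactly one isomorphism of cyclotomes `Λ(K_rat^×) ⥲ Λ(K_rat^×)` induces `κ(𝕄^⊛_∞κ×) ⥲ κ(𝕄^⊛_∞κ×)` on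
`lim_{→ i} H¹(S i, Λ(K_rat^×))`, GIVEN `hcoe`, `hprim`, injectivity of `κ`, (b′) `hordx` and Rmk 3.1.7 (i)/(ii)
`hpolex`/`hexx` on the `π₁^rat`-fixed ∞κ×-coric functions — the binders of abc-iut-w4-d056's conjunct-2 closer
`existsUniqueCoricStructure_infκxPair_kummerMap`, minus `h1`/`hpow` and the naturality law `hnatx`.  PROVED.
([IUTchI] Ex 5.1 (v) p.128) [claim: Mochizuki2012, status: disputed] -/
theorem uniqueCyclotomeIso_infκx_kummerMap
    (hcoe : ∀ (g : N.piRat) (a : N.Kratˣ), ((g • a : N.Kratˣ) : N.Krat) = g • (a : N.Krat))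
    (hprim : ∀ n : ℕ, 0 < n → ∃ ζ : N.Krat, IsPrimitiveRoot ζ n) (hc : IsExhausted N.Kratˣ S)
    (hinj : Function.Injective (kummerMap hS hc))
    {X : Type*} (ord : X → N.Krat → ℤ)
    (hordx : ∀ (u : MulAut (completion (GrpCat.of (Multiplicative ℤ)))) (f f' : N.infκxPair.carrier),
      (∀ g : N.piRat, g • (f : N.Krat) = f) → (∀ g : N.piRat, g • (f' : N.Krat) = f') →
      kummerMap hS hc (Units.mk0 (f' : N.Krat) (N.coe_ne_zero_of_subset N.Minfκx _ N.zero_notMem f')) =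
        H1ColimTwist S hS u
          (kummerMap hS hc (Units.mk0 (f : N.Krat) (N.coe_ne_zero_of_subset N.Minfκx _ N.zero_notMem f))) →
      ∀ x : X, u (eta (ord x f)) = eta (ord x f'))
    (hpolex : ∀ f' ∈ N.Minfκx, (∀ g : N.piRat, g • f' = f') →
      ∀ x₁ x₂ : X, x₁ ≠ x₂ → ¬ (ord x₁ f' < 0 ∧ ord x₂ f' < 0))
    (hexx : ∃ f ∈ N.Minfκx, (∀ g : N.piRat, g • f = f) ∧
      ∃ x₁ x₂ : X, x₁ ≠ x₂ ∧ 0 < ord x₁ f ∧ 0 < ord x₂ f) :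
    UniqueCyclotomeIso
      { μ₁ := cyclotome N.Kratˣ
        μ₂ := cyclotome N.Kratˣ
        H₁ := H1Colimit N.Kratˣ S hS
        H₂ := H1Colimit N.Kratˣ S hS
        im₁ := Set.range fun f : N.infκxPair.carrier =>
          kummerMap hS hc (Units.mk0 (f : N.Krat) (N.coe_ne_zero_of_subset N.Minfκx _ N.zero_notMem f))
        im₂ := Set.range fun f : N.infκxPair.carrier =>
          kummerMap hS hc (Units.mk0 (f : N.Krat) (N.coe_ne_zero_of_subset N.Minfκx _ N.zero_notMem f))
        induced := fun e => H1ColimTwist S hS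
          ((Equiv.ofBijective _ (cyclotome.zhatTwist_bijective (R := N.Krat) hprim)).symm e) } :=
  N.uniqueCyclotomeIso_subset_kummerMap N.Minfκx _ S hS N.zero_notMem hcoe hprim hc hinj ord hordx hpolex hexx

/-- **"Respectively, `∞κ×`", with (b′) from the additivity of `ord_x` on fixed functions (o)** (+ finite index).
PROVED. ([IUTchI] Ex 5.1 (v) p.128) [claim: Mochizuki2012, status: disputed] -/
theorem uniqueCyclotomeIso_infκx_of_ordHom
    (hcoe : ∀ (g : N.piRat) (a : N.Kratˣ), ((g • a : N.Kratˣ) : N.Krat) = g • (a : N.Krat))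
    (hprim : ∀ n : ℕ, 0 < n → ∃ ζ : N.Krat, IsPrimitiveRoot ζ n) (hc : IsExhausted N.Kratˣ S)
    (hfi : ∀ i, (S i).FiniteIndex) (hinj : Function.Injective (kummerMap hS hc))
    {X : Type*} (ord : X → N.Krat → ℤ)
    (hordmul : ∀ (x : X) (a b : N.Krat), a ≠ 0 → b ≠ 0 → (∀ g : N.piRat, g • a = a) → (∀ g : N.piRat, g • b = b) →
      ord x (a * b) = ord x a + ord x b)
    (hpolex : ∀ f' ∈ N.Minfκx, (∀ g : N.piRat, g • f' = f') →
      ∀ x₁ x₂ : X, x₁ ≠ x₂ → ¬ (ord x₁ f' < 0 ∧ ord x₂ f' < 0))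
    (hexx : ∃ f ∈ N.Minfκx, (∀ g : N.piRat, g • f = f) ∧
      ∃ x₁ x₂ : X, x₁ ≠ x₂ ∧ 0 < ord x₁ f ∧ 0 < ord x₂ f) :
    UniqueCyclotomeIso
      { μ₁ := cyclotome N.Kratˣ
        μ₂ := cyclotome N.Kratˣ
        H₁ := H1Colimit N.Kratˣ S hS
        H₂ := H1Colimit N.Kratˣ S hS
        im₁ := Set.range fun f : N.infκxPair.carrier =>
          kummerMap hS hc (Units.mk0 (f : N.Krat) (N.coe_ne_zero_of_subset N.Minfκx _ N.zero_notMem f))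
        im₂ := Set.range fun f : N.infκxPair.carrier =>
          kummerMap hS hc (Units.mk0 (f : N.Krat) (N.coe_ne_zero_of_subset N.Minfκx _ N.zero_notMem f))
        induced := fun e => H1ColimTwist S hS
          ((Equiv.ofBijective _ (cyclotome.zhatTwist_bijective (R := N.Krat) hprim)).symm e) } :=
  N.uniqueCyclotomeIso_subset_of_ordHom N.Minfκx _ S hS N.zero_notMem hcoe hprim hc hfi hinj ord hordmul hpolex hexx

include hS in
/-- **"Respectively, `∞κ×`", modulo laws of the genuine Galois action only** ((iv) `hdiv` instead of the
injectivity of `κ`).  PROVED. ([IUTchI] Ex 5.1 (v) p.128) [claim: Mochizuki2012, status: disputed] -/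
theorem uniqueCyclotomeIso_infκx_of_ordHom_of_fixedRoots
    (hcoe : ∀ (g : N.piRat) (a : N.Kratˣ), ((g • a : N.Kratˣ) : N.Krat) = g • (a : N.Krat))
    (hprim : ∀ n : ℕ, 0 < n → ∃ ζ : N.Krat, IsPrimitiveRoot ζ n) (hc : IsExhausted N.Kratˣ S)
    (hfi : ∀ i, (S i).FiniteIndex)
    (hdiv : ∀ (i : ι) (a : N.Kratˣ), a ∈ invariants (A := N.Kratˣ) (S i) →
      (∀ n : ℕ+, ∃ b ∈ invariants (A := N.Kratˣ) (S i), b ^ (n : ℕ) = a) → a = 1)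
    {X : Type*} (ord : X → N.Krat → ℤ)
    (hordmul : ∀ (x : X) (a b : N.Krat), a ≠ 0 → b ≠ 0 → (∀ g : N.piRat, g • a = a) → (∀ g : N.piRat, g • b = b) →
      ord x (a * b) = ord x a + ord x b)
    (hpolex : ∀ f' ∈ N.Minfκx, (∀ g : N.piRat, g • f' = f') →
      ∀ x₁ x₂ : X, x₁ ≠ x₂ → ¬ (ord x₁ f' < 0 ∧ ord x₂ f' < 0))
    (hexx : ∃ f ∈ N.Minfκx, (∀ g : N.piRat, g • f = f) ∧
      ∃ x₁ x₂ : X, x₁ ≠ x₂ ∧ 0 < ord x₁ f ∧ 0 < ord x₂ f) :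
    UniqueCyclotomeIso
      { μ₁ := cyclotome N.Kratˣ
        μ₂ := cyclotome N.Kratˣ
        H₁ := H1Colimit N.Kratˣ S hS
        H₂ := H1Colimit N.Kratˣ S hS
        im₁ := Set.range fun f : N.infκxPair.carrier =>
          kummerMap hS hc (Units.mk0 (f : N.Krat) (N.coe_ne_zero_of_subset N.Minfκx _ N.zero_notMem f))
        im₂ := Set.range fun f : N.infκxPair.carrier =>
          kummerMap hS hc (Units.mk0 (f : N.Krat) (N.coe_ne_zero_of_subset N.Minfκx _ N.zero_notMem f))
        induced := fun e => H1ColimTwist S hS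
          ((Equiv.ofBijective _ (cyclotome.zhatTwist_bijective (R := N.Krat) hprim)).symm e) } :=
  N.uniqueCyclotomeIso_infκx_of_ordHom S hS hcoe hprim hc hfi
    (fun a b hab => Additive.ofMul.injective (kummerMapHom_injective_of S hS hc hdiv (a₁ := Additive.ofMul a)
      (a₂ := Additive.ofMul b) hab)) ord hordmul hpolex hexx

end Infκx

section InfκxCanonical

variable (N : NFBridgeRecon.{0})

open scoped Classical in
/-- **"Respectively, `∞κ×`", over ALL OPEN NORMAL SUBGROUPS of `π₁^rat(†𝒟^⊛)`** (canonical levels; hypotheses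
`[MulDistribMulAction π₁^rat K_rat^×]` + `hcoe`, `[RootableBy K_rat^× ℕ]`, `hprim`, (iv) `hdiv`, (o) `hordmul`,
Rmk 3.1.7 (i)/(ii) `hpolex`/`hexx`).  PROVED. ([IUTchI] Ex 5.1 (v) p.128) [claim: Mochizuki2012, status: disputed] -/
theorem uniqueCyclotomeIso_infκx_canonical [MulDistribMulAction N.piRat N.Kratˣ] [RootableBy N.Kratˣ ℕ]
    (hcoe : ∀ (g : N.piRat) (a : N.Kratˣ), ((g • a : N.Kratˣ) : N.Krat) = g • (a : N.Krat))
    (hprim : ∀ n : ℕ, 0 < n → ∃ ζ : N.Krat, IsPrimitiveRoot ζ n)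
    (hdiv : ∀ (H : OpenNormalSubgroup N.piRat) (a : N.Kratˣ), a ∈ invariants (A := N.Kratˣ) (H : Subgroup N.piRat) →
      (∀ n : ℕ+, ∃ b ∈ invariants (A := N.Kratˣ) (H : Subgroup N.piRat), b ^ (n : ℕ) = a) → a = 1)
    {X : Type*} (ord : X → N.Krat → ℤ)
    (hordmul : ∀ (x : X) (a b : N.Krat), a ≠ 0 → b ≠ 0 → (∀ g : N.piRat, g • a = a) → (∀ g : N.piRat, g • b = b) →
      ord x (a * b) = ord x a + ord x b)
    (hpolex : ∀ f' ∈ N.Minfκx, (∀ g : N.piRat, g • f' = f') →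
      ∀ x₁ x₂ : X, x₁ ≠ x₂ → ¬ (ord x₁ f' < 0 ∧ ord x₂ f' < 0))
    (hexx : ∃ f ∈ N.Minfκx, (∀ g : N.piRat, g • f = f) ∧
      ∃ x₁ x₂ : X, x₁ ≠ x₂ ∧ 0 < ord x₁ f ∧ 0 < ord x₂ f) :
    haveI : Nonempty (OpenNormalSubgroup N.piRat)ᵒᵈ :=
      ⟨OrderDual.toDual { toOpenSubgroup := ⊤, isNormal' := Subgroup.normal_of_characteristic ⊤ }⟩
    UniqueCyclotomeIso
      { μ₁ := cyclotome N.Kratˣ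
        μ₂ := cyclotome N.Kratˣ
        H₁ := H1Colimit N.Kratˣ
          (fun i : (OpenNormalSubgroup N.piRat)ᵒᵈ => ((OrderDual.ofDual i : OpenNormalSubgroup N.piRat) : Subgroup N.piRat))
          N.openNormal_antitone
        H₂ := H1Colimit N.Kratˣ
          (fun i : (OpenNormalSubgroup N.piRat)ᵒᵈ => ((OrderDual.ofDual i : OpenNormalSubgroup N.piRat) : Subgroup N.piRat))
          N.openNormal_antitone
        im₁ := Set.range fun f : N.infκxPair.carrier =>
          kummerMap N.openNormal_antitone (N.isExhausted_openNormal hcoe)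
            (Units.mk0 (f : N.Krat) (N.coe_ne_zero_of_subset N.Minfκx _ N.zero_notMem f))
        im₂ := Set.range fun f : N.infκxPair.carrier =>
          kummerMap N.openNormal_antitone (N.isExhausted_openNormal hcoe)
            (Units.mk0 (f : N.Krat) (N.coe_ne_zero_of_subset N.Minfκx _ N.zero_notMem f))
        induced := fun e => H1ColimTwist
          (fun i : (OpenNormalSubgroup N.piRat)ᵒᵈ => ((OrderDual.ofDual i : OpenNormalSubgroup N.piRat) : Subgroup N.piRat))
          N.openNormal_antitone
          ((Equiv.ofBijective _ (cyclotome.zhatTwist_bijective (R := N.Krat) hprim)).symm e) } := by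
  haveI : Nonempty (OpenNormalSubgroup N.piRat)ᵒᵈ :=
    ⟨OrderDual.toDual { toOpenSubgroup := ⊤, isNormal' := Subgroup.normal_of_characteristic ⊤ }⟩
  exact N.uniqueCyclotomeIso_infκx_of_ordHom_of_fixedRoots
    (fun i : (OpenNormalSubgroup N.piRat)ᵒᵈ => ((OrderDual.ofDual i : OpenNormalSubgroup N.piRat) : Subgroup N.piRat))
    N.openNormal_antitone hcoe hprim (N.isExhausted_openNormal hcoe) N.openNormal_finiteIndex
    (fun i a => hdiv (OrderDual.ofDual i) a) ord hordmul hpolex hexx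

open scoped Classical in
/-- **"Respectively, `∞κ×`" — FIELD-LEVEL FORM** (units action := `Units.mulDistribMulActionRight`, rootability from
`hrootU`, (iv) `hdiv` at field level): binders `hrootU hprim hdiv ord hordmul hpolex hexx` = those of conjunct 2's
field-level closer `existsUniqueCoricStructure_infκxPair_fieldLevel` (p436822) minus `h1`/`hpow`.  PROVED.
([IUTchI] Ex 5.1 (v) p.128) [claim: Mochizuki2012, status: disputed] -/
theorem uniqueCyclotomeIso_infκx_fieldLevel
    (hrootU : ∀ {n : ℕ}, n ≠ 0 → Function.Surjective fun a : N.Kratˣ => a ^ n)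
    (hprim : ∀ n : ℕ, 0 < n → ∃ ζ : N.Krat, IsPrimitiveRoot ζ n)
    (hdiv : ∀ (H : OpenNormalSubgroup N.piRat) (a : N.Krat), a ≠ 0 → (∀ h : N.piRat, h ∈ H → h • a = a) →
      (∀ n : ℕ+, ∃ b : N.Krat, (∀ h : N.piRat, h ∈ H → h • b = b) ∧ b ^ (n : ℕ) = a) → a = 1)
    {X : Type*} (ord : X → N.Krat → ℤ)
    (hordmul : ∀ (x : X) (a b : N.Krat), a ≠ 0 → b ≠ 0 → (∀ g : N.piRat, g • a = a) → (∀ g : N.piRat, g • b = b) →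
      ord x (a * b) = ord x a + ord x b)
    (hpolex : ∀ f' ∈ N.Minfκx, (∀ g : N.piRat, g • f' = f') →
      ∀ x₁ x₂ : X, x₁ ≠ x₂ → ¬ (ord x₁ f' < 0 ∧ ord x₂ f' < 0))
    (hexx : ∃ f ∈ N.Minfκx, (∀ g : N.piRat, g • f = f) ∧
      ∃ x₁ x₂ : X, x₁ ≠ x₂ ∧ 0 < ord x₁ f ∧ 0 < ord x₂ f) :
    letI : MulDistribMulAction N.piRat N.Kratˣ := Units.mulDistribMulActionRight
    letI : RootableBy N.Kratˣ ℕ := rootableByOfPowLeftSurj N.Kratˣ ℕ hrootU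
    haveI : Nonempty (OpenNormalSubgroup N.piRat)ᵒᵈ :=
      ⟨OrderDual.toDual { toOpenSubgroup := ⊤, isNormal' := Subgroup.normal_of_characteristic ⊤ }⟩
    UniqueCyclotomeIso
      { μ₁ := cyclotome N.Kratˣ
        μ₂ := cyclotome N.Kratˣ
        H₁ := H1Colimit N.Kratˣ
          (fun i : (OpenNormalSubgroup N.piRat)ᵒᵈ => ((OrderDual.ofDual i : OpenNormalSubgroup N.piRat) : Subgroup N.piRat))
          N.openNormal_antitone
        H₂ := H1Colimit N.Kratˣ
          (fun i : (OpenNormalSubgroup N.piRat)ᵒᵈ => ((OrderDual.ofDual i : OpenNormalSubgroup N.piRat) : Subgroup N.piRat))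
          N.openNormal_antitone
        im₁ := Set.range fun f : N.infκxPair.carrier =>
          kummerMap N.openNormal_antitone (N.isExhausted_openNormal fun _ _ => rfl)
            (Units.mk0 (f : N.Krat) (N.coe_ne_zero_of_subset N.Minfκx _ N.zero_notMem f))
        im₂ := Set.range fun f : N.infκxPair.carrier =>
          kummerMap N.openNormal_antitone (N.isExhausted_openNormal fun _ _ => rfl)
            (Units.mk0 (f : N.Krat) (N.coe_ne_zero_of_subset N.Minfκx _ N.zero_notMem f))
        induced := fun e => H1ColimTwist
          (fun i : (OpenNormalSubgroup N.piRat)ᵒᵈ => ((OrderDual.ofDual i : OpenNormalSubgroup N.piRat) : Subgroup N.piRat))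
          N.openNormal_antitone
          ((Equiv.ofBijective _ (cyclotome.zhatTwist_bijective (R := N.Krat) hprim)).symm e) } := by
  letI : MulDistribMulAction N.piRat N.Kratˣ := Units.mulDistribMulActionRight
  letI : RootableBy N.Kratˣ ℕ := rootableByOfPowLeftSurj N.Kratˣ ℕ hrootU
  exact N.uniqueCyclotomeIso_infκx_canonical (fun _ _ => rfl) hprim
    (fun H a ha hroots => N.hdiv_units_of_field hdiv H a ha hroots) ord hordmul hpolex hexx

end InfκxCanonical

end NFBridgeRecon

end Literature.IUT.HodgeTheaters
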